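import Summits.BirchSwinnertonDyer.Rank1Residual.Additive.SpecialJTraceFormZero
import Summits.BirchSwinnertonDyer.Rank1Residual.Additive.GordRankOneIwasawaClasses
import Summits.BirchSwinnertonDyer.Rank1Residual.Additive.GordCharLeadingTermExact
import HarnessLib

/-!
# Defect-`3`/`6` (G)-pairs are NON-ANOMALOUS at every degree-one good place unless `4p = 3m² + 1`

HONEST FRAMING (cell `b2b-bsdres`, run/shared/lean/b2b/bsd-rank1-residual/, verbatim in every
file): the goal of the cell is to DELETE the COMBINATION-SHAPED residual classes of the
Birch–Swinnerton-Dyer formula for ALL analytic-rank `≤ 1` elliptic curves over `ℚ` — "full BSD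
formula for every rank `≤ 1` curve in class `C`" assembled STRICTLY from published theorems — so
that the rank-`≤ 1` remainder becomes exactly the CONSTRUCTION-SHAPED classes, which are TYPED
(missing-input `Prop`s), NOT attempted. This is not "finishing BSD". Sub-cell `additive-p2`
(X3♯(G-ord) / X4♯(G-ord)), generation 34, part 2: research route; no claim beyond the stated
classes; theorems only, no definition, no named fact, nothing booked, no label moved.

## What is proved (NUMERICS ⇒ STRUCTURE ⇒ THEOREM)

The companion of gen 11's `GordNonAnomalousFour.lean` (defect `4`, `j̃ = 1728`, `p ≥ 7`: never
anomalous) for the defects `3` and `6` (Kodaira `IV`/`IV*` and `II`/`II*`, `j̃ = 0`), where gen 11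
recorded "anomalous degree-one places DO occur (`p = 7, 19, 37, …`, exactly when `4p = 1 + 3m²`) … no
analogue is claimed". The analogue IS a theorem (part 1, `SpecialJTraceFormZero.lean`: for `j = 0`
over `𝔽_p`, `p ∣ #E(𝔽_p)` forces `4p = 3m² + 1`, by Gauss's trace law `a² + 3m² = 4p`):

* `valuation_j_lt_one_of_three_dvd_semistabilityIndex` — `W/ℚ` globally minimal, `3 ∣ e_E(p)`
  (defect `3` or `6`, i.e. `3 ∤ ord_p Δ_min`), `E_F` good at a place `w ∋ p` of a number field `F`
  ⟹ `w(j) < 1`: the reduction has `j̃ = 0`;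
* **`not_dvd_natCard_point_reductionAt_of_three_dvd_semistabilityIndex`** — if moreover `N(w) = p`,
  `p ≥ 5` and `3m² + 1 ≠ 4p` for every `m`, then **`p ∤ #Ẽ_w(𝔽_p)`**; Greenberg's currency
  `#Ẽ_w(𝔽_p)[p^∞] = 1`; every place above `p` of every subfield of `ℚ(ζ_p)`
  (`…_intermediateField_…`) and of `ℚ(ζ_p)` itself (`…_cyclotomic_…`);
* **`exists_three_mul_sq_add_one_eq_of_dvd_natCard_point_reductionAt_intermediateField`** — the
  census law as printed by the kernel: a defect-`3`/`6` pair that IS anomalous at a place above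
  `p ≥ 5` of a subfield of `ℚ(ζ_p)` has `4p = 3m² + 1` (`p ∈ {7, 19, 37, 61, 127, …}`);
* `exists_trace_sq_add_three_mul_sq_reductionAt_of_three_dvd_semistabilityIndex` — the trace law at
  every degree-one good place of a TYPE-(G) pair of defect `3`/`6` (`3 ∣ e ∣ p − 1`):
  `(p + 1 − #Ẽ_w(𝔽_p))² + 3m² = 4p`;
* **`reductionNonAnomalous_of_three_dvd_semistabilityIndex_of_forall_ne`** — Delbourgo's predicate
  `ReductionNonAnomalous W p` (J. Number Theory 95 (2002) p. 39: "`Ĩ(𝔽_p)` has no `p`-torsion", so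
  `ℓ_p(E) = 1`) holds BY THEOREM on the defect-`3`/`6` rows at every `p ≥ 5` with `4p ≠ 3m² + 1`
  (`p = 13`: `…_thirteen`), whence the 'off the anomalous rows' provisos of the (G)-cell's
  statements are discharged there: `ClassX4Gord/ClassX3Gord.bsdp_rankZero_of_cycChar_…`,
  `…missingLowerBoundAt_rankZero_of_cycLower_…`, `…bsdp_rankOne_of_iwasawaInput_…`
  (gens 18/19 with `hna` supplied), and the rank-`0` EQUIVALENCE
  `ClassX4Gord.bsdp_iff_cycCharLeadingTermAt_rankZero_of_three_dvd_semistabilityIndex_of_forall_ne`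
  (`BSD(E,p)` ⟺ Delbourgo's MC equality at `T = 0`, exact, both directions).

Census pointer (EVIDENCE, `census/anom/ANOM-CENSUS.md` of gen 11, kit pari j103381, 1280 (G-ord)
pairs N < 2·10⁴; re-read gen 34, zero compute): the 334 defect-`3`/`6` rows are anomalous over the
minimal (G)-field `F₀` on 50/261 at `p = 7` and 4/12 at `p = 19`, and on 0/57 at `p = 13`, 0/1 at
`37`, 0/2 at `43`, 0/1 at `97`; `a_𝔭² + 3m² = 4p` is solvable on 334/334 (`a_𝔭 = p + 1 − #Ẽ(𝔽_p)`).

References: B. Mazur, Invent. Math. 18 (1972) 183–266, §5 (anomalous primes); K. Ireland, M. Rosen,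
GTM 84, Ch. 18 §3 Thm. 4; R. Greenberg, LNM 1716 (1999) Thm. 4.1; D. Delbourgo, Compositio Math. 113
(1998) §1.5 (G); J. Number Theory 95 (2002) pp. 39–40; J. H. Silverman, *AEC* VII.5.5, *ATAEC* IV.9
Table 4.1.
-/

noncomputable section

open scoped Classical NumberField

open WeierstrassCurve IsDedekindDomain NumberField IsLocalRing
  Literature.NumberTheory.EllipticCurves Literature.NumberTheory.EllipticCurves.Rank1Residual
  Literature.NumberTheory.EllipticCurves.Rank1Residual.Typed

namespace Summit.BirchSwinnertonDyer.Rank1Residual.Additive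

/-! ### Number fields: degree-one good places with `j ≡ 0` -/

section NumberFieldPlace

variable {F : Type} [Field F] [NumberField F] (V : WeierstrassCurve F) [V.IsElliptic]
  (w : HeightOneSpectrum (𝓞 F)) {p : ℕ}

/-- **The trace law at a degree-one place with `j ≡ 0`**: for `V/F` good at a place `w` with residue
field `𝔽_p` (`N(w) = p`), `p ≥ 5`, `3 ∣ p − 1` and `w(j(V)) < 1`, the reduced curve has `j̃ = 0`
(`reductionAt_j_eq_zero`) and **`(p + 1 − #Ṽ_w(k_w))² + 3m² = 4p`** for some `m ∈ ℤ`.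
[cite: IrelandRosen1990, Ch. 18 §3, Theorem 4] -/
theorem exists_trace_sq_add_three_mul_sq_reductionAt_of_valuation_j_lt_one (hp : p.Prime)
    (hp5 : 5 ≤ p) (h3 : 3 ∣ p - 1) (hN : Ideal.absNorm w.asIdeal = p) (hgood : V.HasGoodReductionAt w)
    (hj : w.valuation F V.j < 1) :
    ∃ m : ℤ, ((p : ℤ) + 1 - Nat.card (V.reductionAt w).toAffine.Point) ^ 2 + 3 * m ^ 2 = 4 * p := by
  haveI : (V.reductionAt w).IsElliptic := isElliptic_reductionAt hgood
  haveI : Fact p.Prime := ⟨hp⟩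
  have hcard := natCard_residueField_adicCompletionIntegers_eq_of_absNorm w hN
  haveI := Fintype.ofFinite (ResidueField (w.adicCompletionIntegers F))
  obtain ⟨hchar, -⟩ := SpecialJ.ringChar_eq_of_natCard_eq
    (k := ResidueField (w.adicCompletionIntegers F)) hp hcard
  have h := SpecialJ.exists_trace_sq_add_three_mul_sq_of_j_eq_zero_of_ringChar_eq (V.reductionAt w)
    hchar hp5 (reductionAt_j_eq_zero V w hgood hj) (by rw [hcard]; exact h3)
  rwa [hcard] at h

/-- **Anomalous at a degree-one place with `j ≡ 0` forces `4p = 3m² + 1`** (`N(w) = p ≥ 5`,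
`V` good at `w`, `w(j) < 1`, `p ∣ #Ṽ_w(k_w)`). Mazur 1972 §5; Ireland–Rosen Ch. 18 §3 Thm. 4.
[cite: IrelandRosen1990, Ch. 18 §3, Theorem 4] -/
theorem exists_three_mul_sq_add_one_eq_of_dvd_natCard_point_reductionAt (hp : p.Prime)
    (hp5 : 5 ≤ p) (hN : Ideal.absNorm w.asIdeal = p) (hgood : V.HasGoodReductionAt w)
    (hj : w.valuation F V.j < 1) (hdvd : p ∣ Nat.card (V.reductionAt w).toAffine.Point) :
    ∃ m : ℕ, 3 * m ^ 2 + 1 = 4 * p := by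
  haveI : (V.reductionAt w).IsElliptic := isElliptic_reductionAt hgood
  exact SpecialJ.exists_three_mul_sq_add_one_eq_of_dvd_natCard_point_of_j_eq_zero (V.reductionAt w)
    hp hp5 (natCard_residueField_adicCompletionIntegers_eq_of_absNorm w hN)
    (reductionAt_j_eq_zero V w hgood hj) hdvd

/-- **Non-anomalous at a degree-one place with `j ≡ 0`** when `3m² + 1 ≠ 4p` for all `m`:
`p ∤ #Ṽ_w(k_w)`. Mazur 1972; Ireland–Rosen Ch. 18 §3 Thm. 4. [cite: IrelandRosen1990, Ch. 18 §3, Theorem 4] -/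
theorem not_dvd_natCard_point_reductionAt_of_valuation_j_lt_one_of_forall_ne (hp : p.Prime)
    (hp5 : 5 ≤ p) (hN : Ideal.absNorm w.asIdeal = p) (hgood : V.HasGoodReductionAt w)
    (hj : w.valuation F V.j < 1) (h : ∀ m : ℕ, 3 * m ^ 2 + 1 ≠ 4 * p) :
    ¬ p ∣ Nat.card (V.reductionAt w).toAffine.Point := fun hdvd ↦ by
  obtain ⟨m, hm⟩ :=
    exists_three_mul_sq_add_one_eq_of_dvd_natCard_point_reductionAt V w hp hp5 hN hgood hj hdvd
  exact h m hm

/-- The same in the currency of Greenberg's Theorem 4.1 (`#Ẽ_v(k_v)_p`): at a degree-one good place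
with `j ≡ 0`, `p ≥ 5`, `3m² + 1 ≠ 4p` for all `m`, **`#Ṽ_w(k_w)[p^∞] = 1`**.
[cite: GreenbergLNM1716, Thm. 4.1] -/
theorem natCard_primaryComponent_point_reductionAt_eq_one_of_valuation_j_lt_one_of_forall_ne
    (hp : p.Prime) (hp5 : 5 ≤ p) (hN : Ideal.absNorm w.asIdeal = p) (hgood : V.HasGoodReductionAt w)
    (hj : w.valuation F V.j < 1) (h : ∀ m : ℕ, 3 * m ^ 2 + 1 ≠ 4 * p) :
    Nat.card (AddCommGroup.primaryComponent (V.reductionAt w).toAffine.Point p) = 1 := by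
  haveI : (V.reductionAt w).IsElliptic := isElliptic_reductionAt hgood
  exact SpecialJ.natCard_primaryComponent_point_eq_one_of_j_eq_zero_of_forall_ne (V.reductionAt w)
    hp hp5 (natCard_residueField_adicCompletionIntegers_eq_of_absNorm w hN)
    (reductionAt_j_eq_zero V w hgood hj) h

end NumberFieldPlace

/-! ### The (G)-cell: semistability defect `3` or `6` (Kodaira `IV`, `IV*`, `II`, `II*`) -/

section Gord

variable (W : WeierstrassCurve ℚ) [W.IsElliptic] [W.IsGloballyMinimal] (p : ℕ) [hp : Fact p.Prime]

/-- **Defect `3` or `6` upstairs means `j ≡ 0`.** For `W/ℚ` globally minimal with `3 ∣ e_E(p)`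
(semistability defect `3` or `6`: `ord_p Δ_min ∈ {2, 4, 8, 10}`, Kodaira `II`, `IV`, `IV*`, `II*`) and
a place `w ∋ p` of a number field `F` at which `E_F` is good: `w(j(E)) < 1` — good reduction
upstairs gives `ord_p j ≥ 0` (`padicValRat_j_nonneg_of_hasGoodReductionAt_baseChange`, gen 9), and
`3 ∣ e` gives `3 ∤ ord_p Δ_min` (`semistabilityIndex_dvd_four_of_three_dvd`), hence `j = 0` or
`ord_p j > 0` (`j_eq_zero_or_padicValRat_j_pos_of_not_three_dvd`, gen 3). The reduction at `w`
therefore has `j̃ = 0`. Silverman *ATAEC* IV.9 Table 4.1. [folklore] -/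
theorem valuation_j_lt_one_of_three_dvd_semistabilityIndex (h3e : 3 ∣ semistabilityIndex W p)
    {F : Type*} [Field F] [NumberField F] {w : HeightOneSpectrum (𝓞 F)}
    (hw : (p : 𝓞 F) ∈ w.asIdeal) (hgood : (W.baseChange F).HasGoodReductionAt w) :
    w.valuation F (W.baseChange F).j < 1 := by
  haveI : (W.baseChange F).IsElliptic := by rw [baseChange]; infer_instance
  have hj : 0 ≤ padicValRat p W.j :=
    padicValRat_j_nonneg_of_hasGoodReductionAt_baseChange W p hw hgood
  have hjF : (W.baseChange F).j = algebraMap ℚ F W.j := W.map_j (algebraMap ℚ F)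
  have h3v : ¬ 3 ∣ padicValInt p W.minimalDiscriminantInt := by
    intro h
    have h34 : 3 ∣ 4 := h3e.trans (semistabilityIndex_dvd_four_of_three_dvd W p h)
    omega
  have hj0 := j_eq_zero_or_padicValRat_j_pos_of_not_three_dvd W p hj h3v
  rw [hjF]
  exact valuation_algebraMap_lt_one_of_padicValRat_pos p w hw hj0

/-- On the type-(G) locus, defect `3` or `6` forces `p ≡ 1 (mod 3)` (`p ≥ 5`): `e ∣ p − 1`
(`typeG_iff_not_subM_and_semistabilityIndex_dvd`, gen 2; Serre–Tate). [folklore] -/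
theorem three_dvd_sub_one_of_typeG_of_three_dvd_semistabilityIndex (hp5 : 5 ≤ p) (hG : TypeG W p)
    (h3e : 3 ∣ semistabilityIndex W p) : 3 ∣ p - 1 :=
  h3e.trans ((typeG_iff_not_subM_and_semistabilityIndex_dvd W p hp5).mp hG).2

/-- **The trace law at every degree-one good place of a defect-`3`/`6` pair, `p ≡ 1 (mod 3)`,
`p ≥ 5`**: for ANY number field `F` and ANY place `w ∋ p` with `N(w) = p` at which `E_F` is good,
**`(p + 1 − #Ẽ_w(𝔽_p))² + 3m² = 4p`** for some `m ∈ ℤ` (the census law `a_𝔭² + 3m² = 4p`, 334/334 rows).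
[cite: IrelandRosen1990, Ch. 18 §3, Theorem 4] -/
theorem exists_trace_sq_add_three_mul_sq_reductionAt_of_three_dvd_semistabilityIndex (hp5 : 5 ≤ p)
    (h3 : 3 ∣ p - 1) (h3e : 3 ∣ semistabilityIndex W p) {F : Type} [Field F] [NumberField F]
    {w : HeightOneSpectrum (𝓞 F)} (hw : (p : 𝓞 F) ∈ w.asIdeal) (hN : Ideal.absNorm w.asIdeal = p)
    (hgood : (W.baseChange F).HasGoodReductionAt w) :
    ∃ m : ℤ, ((p : ℤ) + 1 - Nat.card ((W.baseChange F).reductionAt w).toAffine.Point) ^ 2 + 3 * m ^ 2 =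
      4 * p :=
  haveI : (W.baseChange F).IsElliptic := by rw [baseChange]; infer_instance
  exists_trace_sq_add_three_mul_sq_reductionAt_of_valuation_j_lt_one (W.baseChange F) w hp.out hp5 h3
    hN hgood (valuation_j_lt_one_of_three_dvd_semistabilityIndex W p h3e hw hgood)

/-- **Defect-`3`/`6` additive pairs are non-anomalous at every degree-one good place above `p ≥ 5`
unless `4p = 3m² + 1`.** Let `W` be a globally minimal model of `E/ℚ` with `3 ∣ e_E(p)` at `p ≥ 5`,
and assume `3m² + 1 ≠ 4p` for every `m` (`p = 13, 31, 43, 67, …`). For ANY number field `F` and ANY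
place `w ∋ p` of `F` with residue field `𝔽_p` at which `E_F` has good reduction, `p ∤ #Ẽ_w(𝔽_p)`.
Mazur 1972; Greenberg 1999 Thm. 4.1 (the hypothesis this discharges).
[cite: IrelandRosen1990, Ch. 18 §3, Theorem 4] -/
theorem not_dvd_natCard_point_reductionAt_of_three_dvd_semistabilityIndex (hp5 : 5 ≤ p)
    (h3e : 3 ∣ semistabilityIndex W p) (h : ∀ m : ℕ, 3 * m ^ 2 + 1 ≠ 4 * p)
    {F : Type} [Field F] [NumberField F] {w : HeightOneSpectrum (𝓞 F)} (hw : (p : 𝓞 F) ∈ w.asIdeal)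
    (hN : Ideal.absNorm w.asIdeal = p) (hgood : (W.baseChange F).HasGoodReductionAt w) :
    ¬ p ∣ Nat.card ((W.baseChange F).reductionAt w).toAffine.Point :=
  haveI : (W.baseChange F).IsElliptic := by rw [baseChange]; infer_instance
  not_dvd_natCard_point_reductionAt_of_valuation_j_lt_one_of_forall_ne (W.baseChange F) w hp.out hp5 hN
    hgood (valuation_j_lt_one_of_three_dvd_semistabilityIndex W p h3e hw hgood) h

/-- Greenberg's currency: for a defect-`3`/`6` pair, `p ≥ 5` with `3m² + 1 ≠ 4p` for all `m`, and a
degree-one good place `w ∋ p`, **`#Ẽ_w(𝔽_p)[p^∞] = 1`**. [cite: GreenbergLNM1716, Thm. 4.1] -/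
theorem natCard_primaryComponent_point_reductionAt_eq_one_of_three_dvd_semistabilityIndex
    (hp5 : 5 ≤ p) (h3e : 3 ∣ semistabilityIndex W p) (h : ∀ m : ℕ, 3 * m ^ 2 + 1 ≠ 4 * p)
    {F : Type} [Field F] [NumberField F] {w : HeightOneSpectrum (𝓞 F)} (hw : (p : 𝓞 F) ∈ w.asIdeal)
    (hN : Ideal.absNorm w.asIdeal = p) (hgood : (W.baseChange F).HasGoodReductionAt w) :
    Nat.card (AddCommGroup.primaryComponent ((W.baseChange F).reductionAt w).toAffine.Point p) = 1 :=
  haveI : (W.baseChange F).IsElliptic := by rw [baseChange]; infer_instance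
  natCard_primaryComponent_point_reductionAt_eq_one_of_valuation_j_lt_one_of_forall_ne (W.baseChange F)
    w hp.out hp5 hN hgood (valuation_j_lt_one_of_three_dvd_semistabilityIndex W p h3e hw hgood) h

/-- **On the (G)-cell, defect `3`/`6`: non-anomalous at EVERY place above `p` of every subfield of
`ℚ(ζ_p)`** when `3m² + 1 ≠ 4p` for all `m` (`p ≥ 5`). In a subfield `F ⊆ ℚ(ζ_p)` every place above
`p` has residue degree `1` (`absNorm_eq_of_intermediateField_cyclotomic`, gen 3). In particular over
the minimal (G)-field `F₀` (cubic resp. sextic) and over `ℚ(ζ_p)`.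
[cite: IrelandRosen1990, Ch. 18 §3, Theorem 4] -/
theorem not_dvd_natCard_point_reductionAt_intermediateField_of_three_dvd_semistabilityIndex
    (hp5 : 5 ≤ p) (h3e : 3 ∣ semistabilityIndex W p) (h : ∀ m : ℕ, 3 * m ^ 2 + 1 ≠ 4 * p)
    {L : Type} [Field L] [NumberField L] [IsCyclotomicExtension {p} ℚ L] (F : IntermediateField ℚ L)
    (w : HeightOneSpectrum (𝓞 F)) (hw : (p : 𝓞 F) ∈ w.asIdeal)
    (hgood : (W.baseChange F).HasGoodReductionAt w) :
    ¬ p ∣ Nat.card ((W.baseChange F).reductionAt w).toAffine.Point := by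
  haveI : NumberField F := NumberField.of_module_finite ℚ F
  haveI : w.asIdeal.LiesOver (Ideal.span {(p : ℤ)}) := Ideal.liesOver_span_of_natCast_mem' hp.out hw
  exact not_dvd_natCard_point_reductionAt_of_three_dvd_semistabilityIndex W p hp5 h3e h hw
    (absNorm_eq_of_intermediateField_cyclotomic p F w) hgood

/-- **The census law, kernel form: an ANOMALOUS place of a defect-`3`/`6` pair above `p ≥ 5` in a
subfield of `ℚ(ζ_p)` forces `4p = 3m² + 1`** (`p ∈ {7, 19, 37, 61, 127, 271, …}`; census: all 54
anomalous defect-`3`/`6` rows lie at `p ∈ {7, 19}`). [cite: IrelandRosen1990, Ch. 18 §3, Theorem 4] -/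
theorem exists_three_mul_sq_add_one_eq_of_dvd_natCard_point_reductionAt_intermediateField
    (hp5 : 5 ≤ p) (h3e : 3 ∣ semistabilityIndex W p)
    {L : Type} [Field L] [NumberField L] [IsCyclotomicExtension {p} ℚ L] (F : IntermediateField ℚ L)
    (w : HeightOneSpectrum (𝓞 F)) (hw : (p : 𝓞 F) ∈ w.asIdeal)
    (hgood : (W.baseChange F).HasGoodReductionAt w)
    (hdvd : p ∣ Nat.card ((W.baseChange F).reductionAt w).toAffine.Point) :
    ∃ m : ℕ, 3 * m ^ 2 + 1 = 4 * p := by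
  by_contra hne
  push Not at hne
  exact not_dvd_natCard_point_reductionAt_intermediateField_of_three_dvd_semistabilityIndex W p hp5
    h3e hne F w hw hgood hdvd

/-- **Over `K = ℚ(ζ_p)` itself** (the field of the cell's line V19): for a defect-`3`/`6` pair at
`p ≥ 5` with `3m² + 1 ≠ 4p` for all `m`, and any place `𝔭 ∋ p` of `K` at which `E_K` is good,
`p ∤ #Ẽ_𝔭(𝔽_p)` and `#Ẽ_𝔭(𝔽_p)[p^∞] = 1`. [cite: GreenbergLNM1716, Thm. 4.1] -/
theorem natCard_primaryComponent_point_reductionAt_cyclotomic_eq_one_of_three_dvd_semistabilityIndex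
    (hp5 : 5 ≤ p) (h3e : 3 ∣ semistabilityIndex W p) (h : ∀ m : ℕ, 3 * m ^ 2 + 1 ≠ 4 * p)
    {K : Type} [Field K] [NumberField K] [IsCyclotomicExtension {p} ℚ K]
    {𝔭 : HeightOneSpectrum (𝓞 K)} (h𝔭 : (p : 𝓞 K) ∈ 𝔭.asIdeal)
    (hgood : (W.baseChange K).HasGoodReductionAt 𝔭) :
    ¬ p ∣ Nat.card ((W.baseChange K).reductionAt 𝔭).toAffine.Point ∧
      Nat.card (AddCommGroup.primaryComponent ((W.baseChange K).reductionAt 𝔭).toAffine.Point p)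
        = 1 := by
  obtain ⟨𝔭₀, -, huniq, hN⟩ := exists_prime_over_prime p K
  have h𝔭₀ : 𝔭 = 𝔭₀ := by
    have : 𝔭 ∈ ({𝔭₀} : Set (HeightOneSpectrum (𝓞 K))) := by
      rw [← huniq]; exact_mod_cast h𝔭
    exact this
  subst h𝔭₀
  exact ⟨not_dvd_natCard_point_reductionAt_of_three_dvd_semistabilityIndex W p hp5 h3e h h𝔭 hN hgood,
    natCard_primaryComponent_point_reductionAt_eq_one_of_three_dvd_semistabilityIndex W p hp5 h3e h h𝔭
      hN hgood⟩

/-! ### Delbourgo's `ReductionNonAnomalous` on defect `3`/`6`, and the provisos it discharges -/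

/-- **On the defect-`3`/`6` rows at `p ≥ 5` with `4p ≠ 3m² + 1` the reduction over every (G)-field
is NON-anomalous** (`Delbourgo2002.ReductionNonAnomalous W p`, so `ℓ_p(E) = 1` in Delbourgo 2002
Thm. (B)): `not_dvd_natCard_point_reductionAt_intermediateField_of_three_dvd_semistabilityIndex` is
literally the predicate. [cite: Delbourgo2002, p. 39 (ℓ_p(E) = 1 when Ĩ(𝔽_p) has no p-torsion)] -/
theorem reductionNonAnomalous_of_three_dvd_semistabilityIndex_of_forall_ne (hp5 : 5 ≤ p)
    (h3e : 3 ∣ semistabilityIndex W p) (h : ∀ m : ℕ, 3 * m ^ 2 + 1 ≠ 4 * p) :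
    Delbourgo2002.ReductionNonAnomalous W p :=
  fun _ _ _ _ F w hw hgood ↦
    not_dvd_natCard_point_reductionAt_intermediateField_of_three_dvd_semistabilityIndex W p hp5 h3e h
      F w hw hgood

/-- **`p = 13`**: every defect-`3`/`6` pair is non-anomalous over every (G)-field at `13`
(`4·13 − 1 = 51 = 3·17`, `17` not a square; census: 0/57 rows). [folklore] -/
theorem reductionNonAnomalous_thirteen_of_three_dvd_semistabilityIndex [Fact (Nat.Prime 13)]
    (h3e : 3 ∣ semistabilityIndex W 13) : Delbourgo2002.ReductionNonAnomalous W 13 :=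
  reductionNonAnomalous_of_three_dvd_semistabilityIndex_of_forall_ne W 13 (by norm_num) h3e
    SpecialJ.forall_three_mul_sq_add_one_ne_thirteen

variable {W p}

/-- **X4♯(G-ord) ∩ {II, IV, IV*, II*} (defect `3`/`6`), `p ≥ 5` with `4p ≠ 3m² + 1`, `r_an = 0`,
`E` non-CM: Delbourgo's MC EQUALITY at `T = 0` ⟹ `BSD(E,p)`** — exact, the anomalous proviso of
gen 18's `…_of_cycChar_of_nonAnomalous` discharged by theorem; no image / Tamagawa / Manin / `#Ш_an`
hypothesis. [cite: Delbourgo2002, Theorem (A), (B) (p. 40)] -/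
theorem ClassX4Gord.bsdp_rankZero_of_cycChar_of_three_dvd_semistabilityIndex_of_forall_ne
    (hDel : Delbourgo2002.mainTheorem)
    (hGZK : rank_eq_analyticRank_of_analyticRank_le_one) (hmod : hasEntireLFunction_rat)
    (hX : ClassX4Gord W p) (hcm : ¬ W.HasCM) (hp5 : 5 ≤ p) (h3e : 3 ∣ semistabilityIndex W p)
    (h : ∀ m : ℕ, 3 * m ^ 2 + 1 ≠ 4 * p) (hr : W.analyticRank = 0) (hMC : CycCharLeadingTermAt W p) :
    BSDp W p :=
  ClassX4Gord.bsdp_rankZero_of_cycChar_of_nonAnomalous hDel hGZK hmod hX hcm hp5 hr hMC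
    (reductionNonAnomalous_of_three_dvd_semistabilityIndex_of_forall_ne W p hp5 h3e h)

/-- **X4♯(G-ord) ∩ {II, IV, IV*, II*}, `p ≥ 5` with `4p ≠ 3m² + 1`, `r_an = 0`, `E` non-CM:
`BSD(E,p)` ⟺ Delbourgo's MC EQUALITY at `T = 0`** (`CycCharLeadingTermAt W p`) — BOTH directions
exact on these rows (⟸ the previous theorem; ⟹ gen 18's `cycCharLeadingTermAt_of_bsdp_of_nonAnomalous`
with the proviso discharged). [cite: Delbourgo2002, Theorem (A), (B) (p. 40)] [cite: Miller2011LMS, Def. 1.1] -/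
theorem ClassX4Gord.bsdp_iff_cycCharLeadingTermAt_rankZero_of_three_dvd_semistabilityIndex_of_forall_ne
    (hDel : Delbourgo2002.mainTheorem)
    (hGZK : rank_eq_analyticRank_of_analyticRank_le_one) (hmod : hasEntireLFunction_rat)
    (hX : ClassX4Gord W p) (hcm : ¬ W.HasCM) (hp5 : 5 ≤ p) (h3e : 3 ∣ semistabilityIndex W p)
    (h : ∀ m : ℕ, 3 * m ^ 2 + 1 ≠ 4 * p) (hr : W.analyticRank = 0) :
    BSDp W p ↔ CycCharLeadingTermAt W p :=
  ⟨cycCharLeadingTermAt_of_bsdp_of_nonAnomalous W p hDel hGZK hmod hp5 hcm hX.addv.2 hX.typeGOrd hr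
      (reductionNonAnomalous_of_three_dvd_semistabilityIndex_of_forall_ne W p hp5 h3e h),
    ClassX4Gord.bsdp_rankZero_of_cycChar_of_three_dvd_semistabilityIndex_of_forall_ne hDel hGZK hmod hX
      hcm hp5 h3e h hr⟩

/-- **X4♯(G-ord) ∩ {II, IV, IV*, II*}, `p ≥ 5` with `4p ≠ 3m² + 1`, `r_an = 0`, `E` non-CM: the
LOWER half ⇐ the LOWER divisibility of the MC at `T = 0`** — exact. [cite: Delbourgo2002, Theorem (B) (p. 40)] -/
theorem ClassX4Gord.missingLowerBoundAt_rankZero_of_cycLower_of_three_dvd_semistabilityIndex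
    (hDel : Delbourgo2002.mainTheorem)
    (hGZK : rank_eq_analyticRank_of_analyticRank_le_one) (hmod : hasEntireLFunction_rat)
    (hX : ClassX4Gord W p) (hcm : ¬ W.HasCM) (hp5 : 5 ≤ p) (h3e : 3 ∣ semistabilityIndex W p)
    (h : ∀ m : ℕ, 3 * m ^ 2 + 1 ≠ 4 * p) (hr : W.analyticRank = 0) (hLow : CycLowerLeadingTermAt W p) :
    MissingLowerBoundAt W p :=
  ClassX4Gord.missingLowerBoundAt_rankZero_of_cycLower_of_nonAnomalous hDel hGZK hmod hX hcm hp5 hr hLow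
    (reductionNonAnomalous_of_three_dvd_semistabilityIndex_of_forall_ne W p hp5 h3e h)

/-- **X4♯(G-ord) ∩ {II, IV, IV*, II*}, `p ≥ 5` with `4p ≠ 3m² + 1`, `r_an = 1`, `E` non-CM: the
Iwasawa-route residue `RankOneIwasawaInputAt W p` ⟹ `BSD(E,p)`** — gen 19's statement with the
anomalous proviso discharged by theorem. [cite: Delbourgo2002, Theorem (A), (B) (p. 40)] -/
theorem ClassX4Gord.bsdp_rankOne_of_iwasawaInput_of_three_dvd_semistabilityIndex_of_forall_ne
    (hDel : Delbourgo2002.mainTheorem)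
    (hGZK : rank_eq_analyticRank_of_analyticRank_le_one) (hmod : hasEntireLFunction_rat)
    (hX : ClassX4Gord W p) (hcm : ¬ W.HasCM) (hp5 : 5 ≤ p) (h3e : 3 ∣ semistabilityIndex W p)
    (h : ∀ m : ℕ, 3 * m ^ 2 + 1 ≠ 4 * p) (hr : W.analyticRank = 1) (hIn : RankOneIwasawaInputAt W p) :
    BSDp W p :=
  ClassX4Gord.bsdp_rankOne_of_iwasawaInput_of_nonAnomalous hDel hGZK hmod hX hcm hp5 hr hIn
    (reductionNonAnomalous_of_three_dvd_semistabilityIndex_of_forall_ne W p hp5 h3e h)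

/-- **X3♯(G-ord) ∩ {II, IV, IV*, II*}, `p ≥ 5` with `4p ≠ 3m² + 1`, `r_an = 0`, `E` non-CM: MC
EQUALITY at `T = 0` ⟹ `BSD(E,p)`** — exact. [cite: Delbourgo2002, Theorem (A), (B) (p. 40)] -/
theorem ClassX3Gord.bsdp_rankZero_of_cycChar_of_three_dvd_semistabilityIndex_of_forall_ne
    (hDel : Delbourgo2002.mainTheorem)
    (hGZK : rank_eq_analyticRank_of_analyticRank_le_one) (hmod : hasEntireLFunction_rat)
    (hX : ClassX3Gord W p) (hcm : ¬ W.HasCM) (hp5 : 5 ≤ p) (h3e : 3 ∣ semistabilityIndex W p)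
    (h : ∀ m : ℕ, 3 * m ^ 2 + 1 ≠ 4 * p) (hr : W.analyticRank = 0) (hMC : CycCharLeadingTermAt W p) :
    BSDp W p :=
  ClassX3Gord.bsdp_rankZero_of_cycChar_of_nonAnomalous hDel hGZK hmod hX hcm hp5 hr hMC
    (reductionNonAnomalous_of_three_dvd_semistabilityIndex_of_forall_ne W p hp5 h3e h)

/-- **X3♯(G-ord) ∩ {II, IV, IV*, II*}, `p ≥ 5` with `4p ≠ 3m² + 1`, `r_an = 0`, `E` non-CM: the
LOWER half ⇐ the LOWER divisibility at `T = 0`** — exact. [cite: Delbourgo2002, Theorem (B) (p. 40)] -/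
theorem ClassX3Gord.missingLowerBoundAt_rankZero_of_cycLower_of_three_dvd_semistabilityIndex
    (hDel : Delbourgo2002.mainTheorem)
    (hGZK : rank_eq_analyticRank_of_analyticRank_le_one) (hmod : hasEntireLFunction_rat)
    (hX : ClassX3Gord W p) (hcm : ¬ W.HasCM) (hp5 : 5 ≤ p) (h3e : 3 ∣ semistabilityIndex W p)
    (h : ∀ m : ℕ, 3 * m ^ 2 + 1 ≠ 4 * p) (hr : W.analyticRank = 0) (hLow : CycLowerLeadingTermAt W p) :
    MissingLowerBoundAt W p :=
  ClassX3Gord.missingLowerBoundAt_rankZero_of_cycLower_of_nonAnomalous hDel hGZK hmod hX hcm hp5 hr hLow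
    (reductionNonAnomalous_of_three_dvd_semistabilityIndex_of_forall_ne W p hp5 h3e h)

/-- **X3♯(G-ord) ∩ {II, IV, IV*, II*}, `p ≥ 5` with `4p ≠ 3m² + 1`, `r_an = 1`, `E` non-CM: the
Iwasawa-route residue ⟹ `BSD(E,p)`** — gen 19's statement with the anomalous proviso discharged by
theorem. [cite: Delbourgo2002, Theorem (A), (B) (p. 40)] -/
theorem ClassX3Gord.bsdp_rankOne_of_iwasawaInput_of_three_dvd_semistabilityIndex_of_forall_ne
    (hDel : Delbourgo2002.mainTheorem)
    (hGZK : rank_eq_analyticRank_of_analyticRank_le_one) (hmod : hasEntireLFunction_rat)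
    (hX : ClassX3Gord W p) (hcm : ¬ W.HasCM) (hp5 : 5 ≤ p) (h3e : 3 ∣ semistabilityIndex W p)
    (h : ∀ m : ℕ, 3 * m ^ 2 + 1 ≠ 4 * p) (hr : W.analyticRank = 1) (hIn : RankOneIwasawaInputAt W p) :
    BSDp W p :=
  ClassX3Gord.bsdp_rankOne_of_iwasawaInput_of_nonAnomalous hDel hGZK hmod hX hcm hp5 hr hIn
    (reductionNonAnomalous_of_three_dvd_semistabilityIndex_of_forall_ne W p hp5 h3e h)

end Gord

end Summit.BirchSwinnertonDyer.Rank1Residual.Additive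

end
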